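import Mathlib
import Summits.Ventures.PercRepro2.Defs
import Summits.Ventures.PercRepro2.Independence
import Summits.Ventures.PercRepro2.Harris
import Summits.Ventures.PercRepro2.Graph
import Summits.Ventures.PercRepro2.Exploration
import Summits.Ventures.PercRepro2.Events
import Summits.Ventures.PercRepro2.FourFunctions
import Summits.Ventures.PercRepro2.Induced
import Summits.Ventures.PercRepro2.Frontier
import Summits.Ventures.PercRepro2.ObsIndependence
import Summits.Ventures.PercRepro2.BHK
import Summits.Ventures.PercRepro2.BHKEvents
import Summits.Ventures.PercRepro2.MultiSource
import Summits.Ventures.PercRepro2.OrderPreservation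
import Summits.Ventures.PercRepro2.SeedSet
import Summits.Ventures.PercRepro2.MultiSourceFun
import Summits.Ventures.PercRepro2.CrossRootT
import Summits.Ventures.PercRepro2.VdBKahn
import Summits.Ventures.PercRepro2.HullDefs
import Summits.Ventures.PercRepro2.CCTRootEdge
import Summits.Ventures.PercRepro2.CCTAvoidedEdge
import Summits.Ventures.PercRepro2.R1Rung
import Summits.Ventures.PercRepro2.CC2Rung
import Summits.Ventures.PercRepro2.PASubDefs
import Summits.Ventures.PercRepro2.PASub
import Summits.Ventures.PercRepro2.HalfN
import Summits.Ventures.PercRepro2.PAK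
import Summits.Ventures.PercRepro2.CCTLin
import Summits.Ventures.PercRepro2.L1SDefs
import Summits.Ventures.PercRepro2.LemmaA
import Summits.Ventures.PercRepro2.BasePrime
import Summits.Ventures.PercRepro2.BasePendant
import Summits.Ventures.PercRepro2.L1KPendant

/-!
# (L1-S) at an unmarked pendant edge is the BHK slack on `G − e` (blind cell PercRepro2, typer-1;
lead g11 14:08:43Z "(L1-S), (CC-T⁻) ↦ BHK by identity", 15:28:22Z "type (L1-S) … at unmarked
pendant edges too — it closes the pendant-edge case of the whole linearised family")

Let `e = {l, u}` be a pendant edge whose leaf `l` carries no other edge and is unmarked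
(`l ∉ {s, a, b} ∪ T`). Pinning `e` changes no connection among the other vertices
(`conn_update_leaf_iff`), so on `{S = W}` (`S = C_{ω⁻}(s)`) the `e`-open connection `X⁺ = {s ↔ a in ω⁺}`
is the deterministic `a ∈ W` (`mem_Xplus_iff_mem_of_SEvent`); hence every term of the linearised
joint mass `Ã₁ = Σ_W P(X⁺ ∩ R⁺ ∩ {S = W}) P(Y⁺ ∩ R⁺ ∩ {S = W}) / P(R⁺ ∩ {S = W})` is
`1[a, b ∈ W] · P(R⁺ ∩ {S = W})`, and `Ã₁ = P(X⁺ ∩ Y⁺ ∩ R⁺) = F₁ᵃᵇ = F₀ᵃᵇ` (`linJoint_pendant_eq`).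
With `F₁ = F₀`, `P₁ = P₀` (`massF_update_zero_eq_one_of_notMem`, `L1KPendant.massP_update_zero_eq_one`)
the cleared (L1-S) expression of `SFrame.L1S` is `P₀ · (P₀ F₀ᵃᵇ − F₀ᵃ F₀ᵇ)`, `P(R_T)` times the
two-copy BHK slack of `G − e` (`MineCLemmas.avoidMore_nonneg`, `U = ∅`):

* **`L1S_pendant`**: (L1-S) holds at every unmarked pendant edge (all `n`, all weights).

With `L1KPendant.L1K_pendant` and `CCTMinusPendant.cctMinus_pendant`, every row of the linearised
family 2′CCT-LIN holds at every unmarked pendant edge.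
-/

namespace Summit.Ventures.PercRepro2

namespace L1SPendant

open PASub HalfN TwoSetRung CCTLin SFrame

open scoped Classical

variable {V : Type*} {E : Type*} [Fintype E] [DecidableEq E] [Fintype V] [DecidableEq V]
  {R : Type*} [Field R] [LinearOrder R] [IsStrictOrderedRing R]

variable (p : E → R) (ends : E → Sym2 V) (e : E) (s : V) (T : Finset V)

omit [Fintype E] [Fintype V] [DecidableEq V] in
/-- On `{S = W}`, at an unmarked pendant edge, `X⁺ = {s ↔ a in ω⁺}` is the deterministic `a ∈ W`. -/
lemma mem_Xplus_iff_mem_of_SEvent {l u : V} (hf : ends e = s(l, u))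
    (hleaf : ∀ e', l ∈ ends e' → e' = e) (hlu : l ≠ u) (hls : l ≠ s) {a : V} (hla : l ≠ a)
    {W : Set V} {ω : Config E} (hS : ω ∈ SEvent ends e s W) :
    ω ∈ Xplus ends e s a ↔ a ∈ W := by
  rw [mem_SEvent] at hS
  rw [← hS, mem_cluster]
  simp only [Xplus, Set.mem_setOf_eq]
  rw [conn_update_leaf_iff hf hleaf hlu true hls.symm hla.symm,
    conn_update_leaf_iff hf hleaf hlu false hls.symm hla.symm]

omit [Fintype V] [DecidableEq V] [LinearOrder R] [IsStrictOrderedRing R] in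
/-- `F₀ᴬ = F₁ᴬ` at a pendant edge whose leaf is neither the root, nor in `T`, nor in `A`. -/
lemma massF_update_zero_eq_one_of_notMem {l u : V} (hf : ends e = s(l, u))
    (hleaf : ∀ e', l ∈ ends e' → e' = e) (hlu : l ≠ u) (hls : l ≠ s) (hlT : l ∉ T) {A : Finset V}
    (hlA : l ∉ A) :
    massF (Function.update p e 0) ends s A T = massF (Function.update p e 1) ends s A T := by
  unfold massF
  rw [CCT.prob_update_zero_eq, CCT.prob_update_one_eq]
  congr 1
  ext ω
  simp only [Set.mem_setOf_eq, Set.mem_inter_iff, avoidAll, connAll]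
  have key : ∀ (c : Bool) (x : V), x ≠ l →
      (Conn ends (Function.update ω e c) s x ↔ Conn ends ω s x) :=
    fun c x hx => conn_update_leaf_iff hf hleaf hlu c hls.symm hx
  constructor
  · rintro ⟨h, hA⟩
    refine ⟨fun x hx => ?_, fun x hx => ?_⟩
    · rw [key true x (fun hxl => hlT (hxl ▸ hx)), ← key false x (fun hxl => hlT (hxl ▸ hx))]
      exact h x hx
    · rw [key true x (fun hxl => hlA (hxl ▸ hx)), ← key false x (fun hxl => hlA (hxl ▸ hx))]
      exact hA x hx
  · rintro ⟨h, hA⟩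
    refine ⟨fun x hx => ?_, fun x hx => ?_⟩
    · rw [key false x (fun hxl => hlT (hxl ▸ hx)), ← key true x (fun hxl => hlT (hxl ▸ hx))]
      exact h x hx
    · rw [key false x (fun hxl => hlA (hxl ▸ hx)), ← key true x (fun hxl => hlA (hxl ▸ hx))]
      exact hA x hx

omit [LinearOrder R] [IsStrictOrderedRing R] in
/-- **The linearised joint mass at an unmarked pendant edge is the joint mass**: `Ã₁ = F₁ᵃᵇ`. -/
theorem linJoint_pendant_eq {l u : V} (hf : ends e = s(l, u))
    (hleaf : ∀ e', l ∈ ends e' → e' = e) (hlu : l ≠ u) (hls : l ≠ s) {a b : V} (hla : l ≠ a)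
    (hlb : l ≠ b) :
    linJoint p ends e s T a b = massF (Function.update p e 1) ends s ({a} ∪ {b}) T := by
  rw [massF_update_one_pair_eq,
    prob_eq_sum_SEvent p ends e s (Xplus ends e s a ∩ Xplus ends e s b ∩ Rplus ends e s T)]
  unfold linJoint
  refine Finset.sum_congr rfl fun W _ => ?_
  have hXa : ∀ ω ∈ SEvent ends e s W, (ω ∈ Xplus ends e s a ↔ a ∈ W) :=
    fun ω hS => mem_Xplus_iff_mem_of_SEvent ends e s hf hleaf hlu hls hla hS
  have hXb : ∀ ω ∈ SEvent ends e s W, (ω ∈ Xplus ends e s b ↔ b ∈ W) :=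
    fun ω hS => mem_Xplus_iff_mem_of_SEvent ends e s hf hleaf hlu hls hlb hS
  by_cases ha : a ∈ W
  · by_cases hb : b ∈ W
    · have e1 : Xplus ends e s a ∩ Rplus ends e s T ∩ SEvent ends e s W =
          Rplus ends e s T ∩ SEvent ends e s W := by
        ext ω
        constructor
        · rintro ⟨⟨_, hR⟩, hS⟩; exact ⟨hR, hS⟩
        · rintro ⟨hR, hS⟩; exact ⟨⟨(hXa ω hS).2 ha, hR⟩, hS⟩
      have e2 : Xplus ends e s b ∩ Rplus ends e s T ∩ SEvent ends e s W =
          Rplus ends e s T ∩ SEvent ends e s W := by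
        ext ω
        constructor
        · rintro ⟨⟨_, hR⟩, hS⟩; exact ⟨hR, hS⟩
        · rintro ⟨hR, hS⟩; exact ⟨⟨(hXb ω hS).2 hb, hR⟩, hS⟩
      have e3 : Xplus ends e s a ∩ Xplus ends e s b ∩ Rplus ends e s T ∩ SEvent ends e s W =
          Rplus ends e s T ∩ SEvent ends e s W := by
        ext ω
        constructor
        · rintro ⟨⟨_, hR⟩, hS⟩; exact ⟨hR, hS⟩
        · rintro ⟨hR, hS⟩; exact ⟨⟨⟨(hXa ω hS).2 ha, (hXb ω hS).2 hb⟩, hR⟩, hS⟩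
      rw [e1, e2, e3, mul_self_div_self]
    · have e2 : Xplus ends e s b ∩ Rplus ends e s T ∩ SEvent ends e s W = ∅ := by
        ext ω
        simp only [Set.mem_empty_iff_false, iff_false]
        rintro ⟨⟨hx, _⟩, hS⟩
        exact hb ((hXb ω hS).1 hx)
      have e3 : Xplus ends e s a ∩ Xplus ends e s b ∩ Rplus ends e s T ∩ SEvent ends e s W = ∅ := by
        ext ω
        simp only [Set.mem_empty_iff_false, iff_false]
        rintro ⟨⟨⟨_, hx⟩, _⟩, hS⟩
        exact hb ((hXb ω hS).1 hx)
      rw [e2, e3, prob_empty, mul_zero, zero_div]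
  · have e1 : Xplus ends e s a ∩ Rplus ends e s T ∩ SEvent ends e s W = ∅ := by
      ext ω
      simp only [Set.mem_empty_iff_false, iff_false]
      rintro ⟨⟨hx, _⟩, hS⟩
      exact ha ((hXa ω hS).1 hx)
    have e3 : Xplus ends e s a ∩ Xplus ends e s b ∩ Rplus ends e s T ∩ SEvent ends e s W = ∅ := by
      ext ω
      simp only [Set.mem_empty_iff_false, iff_false]
      rintro ⟨⟨⟨hx, _⟩, _⟩, hS⟩
      exact ha ((hXa ω hS).1 hx)
    rw [e1, e3, prob_empty, zero_mul, zero_div]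

/-- **(L1-S) at an unmarked pendant edge** (`e = {l, u}`, `l` a leaf with `l ∉ {s, a, b} ∪ T`):
the cleared expression is `P₀ · (P₀ F₀ᵃᵇ − F₀ᵃ F₀ᵇ) ≥ 0`, the two-copy BHK slack of `G − e`. -/
theorem L1S_pendant (hp : IsProbVec p) {l u : V} (hf : ends e = s(l, u))
    (hleaf : ∀ e', l ∈ ends e' → e' = e) (hlu : l ≠ u) (hls : l ≠ s) (hlT : l ∉ T) {a b : V}
    (hla : l ≠ a) (hlb : l ≠ b) : L1S p ends e s T a b := by
  unfold L1S
  have hab : l ∉ ({a} ∪ {b} : Finset V) := by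
    simp only [Finset.mem_union, Finset.mem_singleton, not_or]
    exact ⟨hla, hlb⟩
  have ha' : l ∉ ({a} : Finset V) := by simp only [Finset.mem_singleton]; exact hla
  have hb' : l ∉ ({b} : Finset V) := by simp only [Finset.mem_singleton]; exact hlb
  rw [linJoint_pendant_eq p ends e s T hf hleaf hlu hls hla hlb,
    ← massF_update_zero_eq_one_of_notMem p ends e s T hf hleaf hlu hls hlT hab,
    ← massF_update_zero_eq_one_of_notMem p ends e s T hf hleaf hlu hls hlT ha',
    ← massF_update_zero_eq_one_of_notMem p ends e s T hf hleaf hlu hls hlT hb',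
    ← L1KPendant.massP_update_zero_eq_one p ends e s T hf hleaf hlu hls hlT]
  have hp₀ : IsProbVec (Function.update p e 0) := hp.update e le_rfl zero_le_one
  have key := MineCLemmas.avoidMore_nonneg (Function.update p e 0) ends hp₀ s {a} {b} T ∅
  rw [Finset.union_empty, Set.inter_comm (connAll ends s ({a} ∪ {b})),
    Set.inter_comm (connAll ends s {a}), Set.inter_comm (connAll ends s {b})] at key
  unfold massP massF
  linarith [key]

end L1SPendant

end Summit.Ventures.PercRepro2
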